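import Summits.BirchSwinnertonDyer.Rank1Residual.GaloisImage.SakamotoN11InstanceDeepTower
import Summits.BirchSwinnertonDyer.Rank1Residual.GaloisImage.SakamotoN11InstanceCanonical
import Summits.BirchSwinnertonDyer.Rank1Residual.GaloisImage.SakamotoN11InstanceFitting
import Summits.BirchSwinnertonDyer.Rank1Residual.GaloisImage.FrobeniusClassIndependence
import Summits.BirchSwinnertonDyer.Rank1Residual.GaloisImage.KolyvaginPropagatedLevelCount
import Summits.BirchSwinnertonDyer.Rank1Residual.GaloisImage.PropagatedStructureUnramified
import Summits.BirchSwinnertonDyer.Rank1Residual.GaloisImage.SelmerPairPairing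
import Literature.NumberTheory.EllipticCurves.SelmerFiniteProofs
import HarnessLib

/-!
# The `3`-adic TOWER PACKAGING of the END theorem's deep binders on class A1 (every depth pinned)
# (cell `b2b-bsdres`, team n1011, ROUTE-1 R1-45 (a)+(c), row T-R1-45 FILE D; seat p18)

HONEST FRAMING (cell `b2b-bsdres`, run/shared/lean/b2b/bsd-rank1-residual/, verbatim in every
file): the goal of the cell is to DELETE the COMBINATION-SHAPED residual classes of the
Birch–Swinnerton-Dyer formula for ALL analytic-rank `≤ 1` elliptic curves over `ℚ` — "full BSD
formula for every rank `≤ 1` curve in class `C`" assembled STRICTLY from published theorems — so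
that the rank-`≤ 1` remainder becomes exactly the CONSTRUCTION-SHAPED classes, which are TYPED
(missing-input `Prop`s), NOT attempted. This is not "finishing BSD". Team n1011 (N10/N11, the
additive block `X4 ∧ p = 3`): research route; TOOL theorems only (no definition, no named fact);
CONDITIONAL on the two named facts `hS24` / `hS24₂` ([S24] Thm. 4.4 (1)(2), the cell's pinned
instances) exactly as n1011-p13's instances are; nothing booked; no mark / label moved.

## What and why

The END THEOREM of sub-route (a′) (`Assembly.padicValRat_le_of_kolyvaginProduct_of_card_torsion_le`,
p278772 over p276707 / p271924) quantifies over families indexed by the depth `k′`: a Kolyvagin datum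
`D′ k′` for `E[3^{k′+1}]`, its transverse shape, its generator `g′ k′` of `KS₁` with order and
ℕ-generation, [S24] Thm. 4.4 (2) in ORDER form at every level (`hR22′`), Rubin's local shape `hUT′`,
`hPS′`, admissible sets `T k′` with `hT`/`h𝓕T`/`h𝓚T`, finiteness `hfinT`/`hfinS`, the reduction maps
`red k′` with `hred`, and `hPP′ : (D′ k′).primes ⊆ D.primes`.  On class A1 (every depth PINNED:
the datum at depth `k′` lives on Sakamoto's class through `E[3^{k′+1}]` itself) ALL of these are
theorems of the tree given the `3`-adic tower, the two named facts, the Poitou–Tate family at `3`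
and Tate's `hEP`; this file packages them ONCE (planner r1, ROUTE-1 §27.2 / §27.6 R1-45 (a)(c)):

* (the reduction maps `red k′ : E[3^{k′+1}] → E[3^{k+1}]`, `x ↦ 3^{k′−k} x`, with `hred`, are
  n1011-p11's `exists_torsionReduction_three`, p278322 — consumed by name in the END corollary);
* `TowerPackage.exists_generator_kolyvaginSystems_of_towerSurj` — at ONE depth, pinned: the
  twin of n1011-p15's `exists_generator_kolyvaginSystems_deep_of_towerSurj` on the facts
  `hS24`/`hS24₂` instead of the S24-DEEP ports (p13's `…_of_towerSurj` instances with `hS′`/`hunr`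
  (p05), core rank (p04, T-Lp), unramified orthogonality (p04, T-UO-K) discharged, and ONE
  generator `κ` serving (1) and (2));
* `TowerPackage.exists_pinnedPackage_at` — at ONE depth: `τ` (from the tower), `η`, the canonical
  datum, the generator and the ORDER form, all ∃-packaged;
* `TowerPackage.exists_towerFamily` — by choice over all depths: the families
  `τ, η, D′, g′` with every per-depth property the END theorem consumes (`hDT′`, `hP′`, `hD′`,
  `hg′`, `hgo′`, `hgen′`, `hR22′`, `hUT′`, `hPS′`) and `hPP′` against depth `0` by the class
  independence (`FrobShape.frobeniusClassPrimes_pow_mul_subset_of_le`, this seat's FILE B);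
* `TowerPackage.towerAdmissible` — the datum-independent families in the `T`-currency for
  `T k′ := {v ∣ 3} ∪ {bad v}`: `hT`, `h𝓕T`, `h𝓚T`, `hfinT`, `hfinS`.

Binders left (nothing hidden): `hS24`, `hS24₂`, the tower, `inv` ×3 at `3`, `hEP`; the
full-level families `inv′ k′` enter `hR22′` universally quantified (three properties, p271924's
spelling after T-UO-K).  Class A2 (deep) twin: n1011-p15's T-S24D files + the same choice — next file.

References: R. Sakamoto, JTNB 36 (2024) §2, Thm. 4.4 [Sakamoto2024]; B. Mazur, K. Rubin, Mem. AMS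
799 (2004) Thm. 3.2.4, §3.5 [MazurRubin2004]; K. Rubin, PCMI 18 (2011) Prop. 1.9.5, Def. 2.1.3
[Rubin2011]; J. H. Silverman, *AEC* (2009) VII.4.1, X.4.2 [SilvermanAEC2009].
-/

noncomputable section

open scoped Classical NumberField ContRepresentation
open Function Field NumberField IsDedekindDomain WeierstrassCurve
  Literature.NumberTheory.EllipticCurves
  Literature.NumberTheory.GaloisRepresentations
  Literature.NumberTheory.GaloisRepresentations.DiscreteGaloisModule Literature.NumberTheory.GaloisCohomology

namespace Summit.BirchSwinnertonDyer.Rank1Residual.GaloisImage.TowerPackage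

variable (W : WeierstrassCurve ℚ) [W.IsElliptic]

/-! ### §1 (the reduction maps `red k′` are n1011-p11's `exists_torsionReduction_three`, p278322) -/

/-! ### §2 ONE depth, pinned: [S24] (1)+(2) with every dischargeable hypothesis discharged -/

/-- **[S24] Thm. 4.4 (1)+(2) at ONE depth on the PINNED class under the `3`-adic tower, one generator
for both** (the pinned twin of n1011-p15's `exists_generator_kolyvaginSystems_deep_of_towerSurj`):
for `S ⊇ ∞ ∪ {3} ∪ {bad}` and the canonical `τ`-datum `D` at depth `k`
(`D.primes = frobeniusClassPrimes ρ_{E,3^{k+1}} {v ∈ S} τ 3^{k+1}`), there is ONE Kolyvagin system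
`κ` which is a `zmultiples`-basis of `KS₁(E[3^{k+1}], 𝓕_can, 𝒫)`, has additive order `3^{k+1}`,
ℕ-generates `KS₁` (the END theorem's `g, hg, hgo, hgen`), AND satisfies Thm. 4.4 (2) in ORDER form
at every level for every full-level Poitou–Tate family `inv′` (`hR22`).  Discharged inside: `hS′`,
`hunr` (p05), the core rank (p04 `hasCoreRank_one_…_of_isPerfect_of_localEuler`), the unramified
orthogonality of both families (p04 `UnramifiedCup.unramifiedOrthogonal_of_isPerfect`).
CONDITIONAL on `hS24`, `hS24₂`. [cite: Sakamoto2024, Thm. 4.4 (1)(2) (p. 926)]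
[cite: MilneADT2006, Ch. I, Thm. 2.8] -/
theorem exists_generator_kolyvaginSystems_of_towerSurj
    (hS24 : Sakamoto2024.kolyvaginSystems_freeRankOne_zmod_three_pow)
    (hS24₂ : Sakamoto2024.kolyvaginSystems_idealOfBasis_eq_fittingIdeal_zmod_three_pow) (k : ℕ)
    [Finite (geomTorsion W ((3 : ℕ) : ℤ))] [Finite (geomTorsion W (((3 : ℕ) : ℤ) ^ k * ((3 : ℕ) : ℤ)))]
    (htower : ∀ n : ℕ, W.HasSurjectiveModNGaloisRep (3 ^ n : ℕ))
    (τ : absoluteGaloisGroup ℚ) (hτμ : τ ∈ rootsOfUnityFixer ℚ (3 ^ (k + 1)))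
    (hτq : Nonempty (cokerSubOne (W.torsionGaloisModule (((3 : ℕ) : ℤ) ^ k * ((3 : ℕ) : ℤ))) τ ≃+
      ZMod (3 ^ (k + 1))))
    (inv : LocalInvariants ℚ 3) (hperf : inv.IsPerfect) (hsum : inv.SumLocalTermEqZero)
    (hcompl : inv.SelmerComplement)
    (hEP : ∀ v : HeightOneSpectrum (𝓞 ℚ), localEulerPoincareCharacteristic (v.adicCompletion ℚ))
    (S : Finset (Place ℚ)) (hS : ∀ w : InfinitePlace ℚ, (Sum.inl w : Place ℚ) ∈ S)
    (h3S : ∀ v : HeightOneSpectrum (𝓞 ℚ), ((3 : ℕ) : 𝓞 ℚ) ∈ v.asIdeal → (Sum.inr v : Place ℚ) ∈ S)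
    (hbadS : ∀ v : HeightOneSpectrum (𝓞 ℚ), ¬ W.HasGoodReductionAt v → (Sum.inr v : Place ℚ) ∈ S)
    (D : KolyvaginDatum (W.torsionGaloisModule (((3 : ℕ) : ℤ) ^ k * ((3 : ℕ) : ℤ))))
    (η : (q : HeightOneSpectrum (𝓞 ℚ)) → (ZMod (Ideal.absNorm q.asIdeal))ˣ)
    (hP : D.primes = frobeniusClassPrimes (W.torsionGaloisModule (((3 : ℕ) : ℤ) ^ k * ((3 : ℕ) : ℤ)))
      {v | (Sum.inr v : Place ℚ) ∈ S} τ (3 ^ (k + 1)))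
    (hT : D.transverse = cyclotomicTransverse (W.torsionGaloisModule (((3 : ℕ) : ℤ) ^ k * ((3 : ℕ) : ℤ))))
    (hD : D.HasCanonicalComparison (3 ^ (k + 1)) η) :
    ∃ κ : D.kolyvaginSystems (propagatedSelmerStructure W 3 k),
      AddSubgroup.zmultiples κ = ⊤ ∧
      addOrderOf (κ.1 : Finset (HeightOneSpectrum (𝓞 ℚ)) →
        galoisCohomology (W.torsionGaloisModule (((3 : ℕ) : ℤ) ^ k * ((3 : ℕ) : ℤ))) 1) = 3 ^ (k + 1) ∧
      (∀ κ' ∈ D.kolyvaginSystems (propagatedSelmerStructure W 3 k), ∃ a : ℕ, κ' = a • κ.1) ∧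
      ∀ (inv' : LocalInvariants ℚ (3 ^ (k + 1))), inv'.IsPerfect → inv'.SumLocalTermEqZero →
        inv'.SelmerComplement →
        ∀ d, D.IsLevel d →
          (Nat.card (inv'.dualSelmerStructure _
              (D.atLevel (propagatedSelmerStructure W 3 k) d)).selmerGroup ∣ 3 ^ (k + 1) →
            addOrderOf (κ.1 d) * Nat.card (inv'.dualSelmerStructure _
              (D.atLevel (propagatedSelmerStructure W 3 k) d)).selmerGroup = 3 ^ (k + 1)) ∧
          (3 ^ (k + 1) ∣ Nat.card (inv'.dualSelmerStructure _
              (D.atLevel (propagatedSelmerStructure W 3 k) d)).selmerGroup → κ.1 d = 0) := by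
  haveI : Fact (Nat.Prime 3) := ⟨Nat.prime_three⟩
  haveI : NeZero (3 ^ (k + 1)) := ⟨pow_ne_zero _ three_ne_zero⟩
  have hunro : inv.UnramifiedOrthogonal :=
    UnramifiedCup.unramifiedOrthogonal_of_isPerfect inv Nat.prime_three.isPrimePow hperf
  have h3T : ∀ v : HeightOneSpectrum (𝓞 ℚ), ((3 : ℕ) : 𝓞 ℚ) ∈ v.asIdeal →
      v ∈ S.preimage Sum.inr Sum.inr_injective.injOn := fun v hv => Finset.mem_preimage.mpr (h3S v hv)
  have hbadT : ∀ v : HeightOneSpectrum (𝓞 ℚ), ¬ W.HasGoodReductionAt v →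
      v ∈ S.preimage Sum.inr Sum.inr_injective.injOn := fun v hv => Finset.mem_preimage.mpr (hbadS v hv)
  have hS' : ∀ v : HeightOneSpectrum (𝓞 ℚ), (Sum.inr v : Place ℚ) ∉ S →
      ((3 : ℕ) : 𝓞 ℚ) ∉ v.asIdeal ∧ GaloisRep.IsUnramifiedAt v
        (W.torsionGaloisModule (((3 : ℕ) : ℤ) ^ k * ((3 : ℕ) : ℤ))) :=
    fun v hv => not_mem_and_isUnramifiedAt_of_not_mem W 3 k S h3S hbadS hv
  have hunr := propagatedSelmerStructure_isUnramifiedOutside W 3 k S hS h3S hbadS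
  have hCR := hasCoreRank_one_propagatedSelmerStructureOne_of_isPerfect_of_localEuler W inv hperf hsum
    hcompl hEP _ h3T hbadT
  have hEP' : ∀ v : HeightOneSpectrum (𝓞 ℚ), (Sum.inr v : Place ℚ) ∈ S →
      localEulerPoincareCharacteristic (v.adicCompletion ℚ) := fun v _ => hEP v
  obtain ⟨hfree, -⟩ := kolyvaginSystems_freeRankOne_propagatedSelmerStructure_of_towerSurj W hS24 k
    htower τ hτμ hτq inv hperf hsum hunro hcompl S hS hS' hunr hEP' hCR D η hP hT hD
  obtain ⟨κ, hκ, hgo, hgen⟩ := exists_basis_of_isFreeRankOneZMod _ hfree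
  refine ⟨κ, hκ, hgo, hgen, fun inv' hperf' hsum' hcompl' d hd => ?_⟩
  have hunro' : inv'.UnramifiedOrthogonal :=
    UnramifiedCup.unramifiedOrthogonal_of_isPerfect inv'
      (Nat.prime_three.isPrimePow.pow (Nat.succ_ne_zero k)) hperf'
  exact kolyvaginSystems_idealOfBasis_propagatedSelmerStructure_of_towerSurj W hS24₂ k htower τ hτμ hτq
    inv hperf hsum hunro hcompl S hS hS' hunr hEP' hCR D η hP hT hD inv' hperf' hsum' hunro' hcompl'
    κ hκ d hd

/-- **Everything at ONE depth, pinned, ∃-packaged**: under the `3`-adic tower, for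
`S ⊇ ∞ ∪ {3} ∪ {bad}`, there are an admissible `τ` at level `3^{k+1}` (from the tower,
`exists_rootsOfUnityFixer_cokerSubOne_equiv_of_towerSurj`), generators `η`, THE canonical
`τ`-datum `D` at depth `k` on Sakamoto's class (p04's T-HCC constructor), and one Kolyvagin system
`g ∈ KS₁` of order `3^{k+1}` that ℕ-generates `KS₁` and satisfies Thm. 4.4 (2) in ORDER form at
every level for every full-level Poitou–Tate family.  CONDITIONAL on `hS24`, `hS24₂`.
[cite: Sakamoto2024, §2 (H.2) and Thm. 4.4 (1)(2) (p. 926)] -/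
theorem exists_pinnedPackage_at
    (hS24 : Sakamoto2024.kolyvaginSystems_freeRankOne_zmod_three_pow)
    (hS24₂ : Sakamoto2024.kolyvaginSystems_idealOfBasis_eq_fittingIdeal_zmod_three_pow) (k : ℕ)
    [hfin : Finite (geomTorsion W (((3 : ℕ) : ℤ) ^ k * ((3 : ℕ) : ℤ)))]
    (htower : ∀ n : ℕ, W.HasSurjectiveModNGaloisRep (3 ^ n : ℕ))
    (inv : LocalInvariants ℚ 3) (hperf : inv.IsPerfect) (hsum : inv.SumLocalTermEqZero)
    (hcompl : inv.SelmerComplement)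
    (hEP : ∀ v : HeightOneSpectrum (𝓞 ℚ), localEulerPoincareCharacteristic (v.adicCompletion ℚ))
    (S : Finset (Place ℚ)) (hS : ∀ w : InfinitePlace ℚ, (Sum.inl w : Place ℚ) ∈ S)
    (h3S : ∀ v : HeightOneSpectrum (𝓞 ℚ), ((3 : ℕ) : 𝓞 ℚ) ∈ v.asIdeal → (Sum.inr v : Place ℚ) ∈ S)
    (hbadS : ∀ v : HeightOneSpectrum (𝓞 ℚ), ¬ W.HasGoodReductionAt v → (Sum.inr v : Place ℚ) ∈ S) :
    ∃ (τ : absoluteGaloisGroup ℚ) (η : (q : HeightOneSpectrum (𝓞 ℚ)) → (ZMod (Ideal.absNorm q.asIdeal))ˣ)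
      (D : KolyvaginDatum (W.torsionGaloisModule (((3 : ℕ) : ℤ) ^ k * ((3 : ℕ) : ℤ))))
      (g : Finset (HeightOneSpectrum (𝓞 ℚ)) →
        galoisCohomology (W.torsionGaloisModule (((3 : ℕ) : ℤ) ^ k * ((3 : ℕ) : ℤ))) 1),
      τ ∈ rootsOfUnityFixer ℚ (3 ^ (k + 1)) ∧
      Nonempty (cokerSubOne (W.torsionGaloisModule (((3 : ℕ) : ℤ) ^ k * ((3 : ℕ) : ℤ))) τ ≃+
        ZMod (3 ^ (k + 1))) ∧
      D.primes = frobeniusClassPrimes (W.torsionGaloisModule (((3 : ℕ) : ℤ) ^ k * ((3 : ℕ) : ℤ)))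
        {v | (Sum.inr v : Place ℚ) ∈ S} τ (3 ^ (k + 1)) ∧
      D.transverse = cyclotomicTransverse (W.torsionGaloisModule (((3 : ℕ) : ℤ) ^ k * ((3 : ℕ) : ℤ))) ∧
      D.HasCanonicalComparison (3 ^ (k + 1)) η ∧
      g ∈ D.kolyvaginSystems (propagatedSelmerStructure W 3 k) ∧
      addOrderOf g = 3 ^ (k + 1) ∧
      (∀ κ' ∈ D.kolyvaginSystems (propagatedSelmerStructure W 3 k), ∃ a : ℕ, κ' = a • g) ∧
      ∀ (inv' : LocalInvariants ℚ (3 ^ (k + 1))), inv'.IsPerfect → inv'.SumLocalTermEqZero →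
        inv'.SelmerComplement →
        ∀ d, D.IsLevel d →
          (Nat.card (inv'.dualSelmerStructure _
              (D.atLevel (propagatedSelmerStructure W 3 k) d)).selmerGroup ∣ 3 ^ (k + 1) →
            addOrderOf (g d) * Nat.card (inv'.dualSelmerStructure _
              (D.atLevel (propagatedSelmerStructure W 3 k) d)).selmerGroup = 3 ^ (k + 1)) ∧
          (3 ^ (k + 1) ∣ Nat.card (inv'.dualSelmerStructure _
              (D.atLevel (propagatedSelmerStructure W 3 k) d)).selmerGroup → g d = 0) := by
  haveI : Fact (Nat.Prime 3) := ⟨Nat.prime_three⟩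
  haveI : Finite (geomTorsion W ((3 : ℕ) : ℤ)) :=
    finite_torsionPoints_holds W (AlgebraicClosure ℚ) (by norm_num)
  obtain ⟨τ, hτμ, hτq⟩ := exists_rootsOfUnityFixer_cokerSubOne_equiv_of_towerSurj W 3 k htower
  obtain ⟨η, D, hP, hT, hD⟩ :=
    FSComp.exists_eta_kolyvaginDatum_hasCanonicalComparison_frobeniusClassPrimes
      (W.torsionGaloisModule (((3 : ℕ) : ℤ) ^ k * ((3 : ℕ) : ℤ))) (3 ^ (k + 1))
      {v | (Sum.inr v : Place ℚ) ∈ S} hτμ hτq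
      (cyclotomicTransverse (W.torsionGaloisModule (((3 : ℕ) : ℤ) ^ k * ((3 : ℕ) : ℤ))))
  obtain ⟨κ, -, hgo, hgen, hR22⟩ := exists_generator_kolyvaginSystems_of_towerSurj W hS24 hS24₂ k
    htower τ hτμ hτq inv hperf hsum hcompl hEP S hS h3S hbadS D η hP hT hD
  exact ⟨τ, η, D, κ.1, hτμ, hτq, hP, hT, hD, κ.2, hgo, hgen, hR22⟩

/-! ### §3 All depths at once: the families of the END theorem (class A1) -/

/-- **The `3`-adic TOWER FAMILY on class A1.**  Under the tower, for `S ⊇ ∞ ∪ {3} ∪ {bad}`, there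
are families indexed by the depth `k′` — an admissible `τ k′` at `3^{k′+1}`, generators `η k′`, THE
canonical `τ k′`-datum `D′ k′` for `E[3^{k′+1}]` on Sakamoto's pinned class, a generator `g′ k′` of
`KS₁` — carrying every per-depth property the END theorem consumes: `hP′`/`hDT′`/`hD′` (shape),
`hg′`/`hgo′`/`hgen′` ([S24] (1)), `hR22′` ([S24] (2), ORDER form, for every full-level PT family),
Rubin's local shape `hUT′` (p270588), `hPS′` (the class avoids `S`), and the NESTING
`(D′ k′).primes ⊆ (D′ 0).primes` (class independence under surj(3), this seat's
`FrobShape.frobeniusClassPrimes_pow_mul_subset_of_le`) — so that `D := D′ 0` is a shallow datum at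
depth `0` with `hPP′`.  CONDITIONAL on `hS24`, `hS24₂`.
[cite: Sakamoto2024, §2 and Thm. 4.4 (1)(2) (p. 926)] [cite: Rubin2011, Prop. 1.9.5 (1) and Def. 2.1.3] -/
theorem exists_towerFamily
    (hS24 : Sakamoto2024.kolyvaginSystems_freeRankOne_zmod_three_pow)
    (hS24₂ : Sakamoto2024.kolyvaginSystems_idealOfBasis_eq_fittingIdeal_zmod_three_pow)
    (htower : ∀ n : ℕ, W.HasSurjectiveModNGaloisRep (3 ^ n : ℕ))
    (inv : LocalInvariants ℚ 3) (hperf : inv.IsPerfect) (hsum : inv.SumLocalTermEqZero)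
    (hcompl : inv.SelmerComplement)
    (hEP : ∀ v : HeightOneSpectrum (𝓞 ℚ), localEulerPoincareCharacteristic (v.adicCompletion ℚ))
    (S : Finset (Place ℚ)) (hS : ∀ w : InfinitePlace ℚ, (Sum.inl w : Place ℚ) ∈ S)
    (h3S : ∀ v : HeightOneSpectrum (𝓞 ℚ), ((3 : ℕ) : 𝓞 ℚ) ∈ v.asIdeal → (Sum.inr v : Place ℚ) ∈ S)
    (hbadS : ∀ v : HeightOneSpectrum (𝓞 ℚ), ¬ W.HasGoodReductionAt v → (Sum.inr v : Place ℚ) ∈ S) :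
    ∃ (τ : ℕ → absoluteGaloisGroup ℚ)
      (η : ℕ → (q : HeightOneSpectrum (𝓞 ℚ)) → (ZMod (Ideal.absNorm q.asIdeal))ˣ)
      (D' : ∀ k' : ℕ, KolyvaginDatum (W.torsionGaloisModule (((3 : ℕ) : ℤ) ^ k' * ((3 : ℕ) : ℤ))))
      (g' : ∀ k' : ℕ, Finset (HeightOneSpectrum (𝓞 ℚ)) →
        galoisCohomology (W.torsionGaloisModule (((3 : ℕ) : ℤ) ^ k' * ((3 : ℕ) : ℤ))) 1),
      (∀ k', τ k' ∈ rootsOfUnityFixer ℚ (3 ^ (k' + 1))) ∧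
      (∀ k', Nonempty (cokerSubOne (W.torsionGaloisModule (((3 : ℕ) : ℤ) ^ k' * ((3 : ℕ) : ℤ))) (τ k')
        ≃+ ZMod (3 ^ (k' + 1)))) ∧
      (∀ k', (D' k').primes = frobeniusClassPrimes
        (W.torsionGaloisModule (((3 : ℕ) : ℤ) ^ k' * ((3 : ℕ) : ℤ))) {v | (Sum.inr v : Place ℚ) ∈ S}
        (τ k') (3 ^ (k' + 1))) ∧
      (∀ k', (D' k').transverse = cyclotomicTransverse _) ∧
      (∀ k', (D' k').HasCanonicalComparison (3 ^ (k' + 1)) (η k')) ∧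
      (∀ k', g' k' ∈ (D' k').kolyvaginSystems (propagatedSelmerStructure W 3 k')) ∧
      (∀ k', addOrderOf (g' k') = 3 ^ (k' + 1)) ∧
      (∀ k', ∀ κ ∈ (D' k').kolyvaginSystems (propagatedSelmerStructure W 3 k'), ∃ a : ℕ, κ = a • g' k') ∧
      (∀ k' (inv' : LocalInvariants ℚ (3 ^ (k' + 1))), inv'.IsPerfect → inv'.SumLocalTermEqZero →
        inv'.SelmerComplement → ∀ d, (D' k').IsLevel d →
          haveI := finite_geomTorsion_pow_mul W 3 k'
          (Nat.card (inv'.dualSelmerStructure _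
              ((D' k').atLevel (propagatedSelmerStructure W 3 k') d)).selmerGroup ∣ 3 ^ (k' + 1) →
            addOrderOf (g' k' d) * Nat.card (inv'.dualSelmerStructure _
              ((D' k').atLevel (propagatedSelmerStructure W 3 k') d)).selmerGroup = 3 ^ (k' + 1)) ∧
          (3 ^ (k' + 1) ∣ Nat.card (inv'.dualSelmerStructure _
              ((D' k').atLevel (propagatedSelmerStructure W 3 k') d)).selmerGroup → g' k' d = 0)) ∧
      (∀ k', ∀ q ∈ (D' k').primes,
        Nat.card (unramifiedSubgroup (GaloisRep.toLocal q
          (W.torsionGaloisModule (((3 : ℕ) : ℤ) ^ k' * ((3 : ℕ) : ℤ)))) 1) =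
          Nat.card ((D' k').transverse (Sum.inr q))) ∧
      (∀ k', ∀ q ∈ (D' k').primes, (Sum.inr q : Place ℚ) ∉ S) ∧
      (∀ k', (D' k').primes ⊆ (D' 0).primes) := by
  haveI : Fact (Nat.Prime 3) := ⟨Nat.prime_three⟩
  choose τ η D g hτμ hτq hP hT hD hg hgo hgen hR22 using fun k' =>
    exists_pinnedPackage_at W hS24 hS24₂ k' (hfin := finite_geomTorsion_pow_mul W 3 k') htower inv
      hperf hsum hcompl hEP S hS h3S hbadS
  refine ⟨τ, η, D, g, hτμ, hτq, hP, hT, hD, hg, hgo, hgen, hR22, fun k' => ?_, fun k' q hq => ?_,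
    fun k' => ?_⟩
  · -- Rubin's local shape at Sakamoto's primes (p270588)
    haveI : NeZero (3 ^ (k' + 1)) := ⟨pow_ne_zero _ three_ne_zero⟩
    haveI := finite_geomTorsion_pow_mul W 3 k'
    exact natCard_unramifiedSubgroup_eq_natCard_transverse_rat_of_primes_eq
      (W.torsionGaloisModule (((3 : ℕ) : ℤ) ^ k' * ((3 : ℕ) : ℤ))) (hP k') (hT k') (hτq k') (hτμ k')
      (pow_succ_nsmul_geomTorsion_eq_zero W 3 k')
  · -- the class avoids `S`
    rw [hP k'] at hq
    exact hq.1
  · -- nesting against depth `0`: class independence under surj(3)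
    rw [hP k', hP 0]
    have h3 : W.HasSurjectiveModNGaloisRep (((3 : ℕ) : ℤ) ^ 0 * ((3 : ℕ) : ℤ)) := by
      simpa using htower 1
    exact FrobShape.frobeniusClassPrimes_pow_mul_subset_of_le W 3 (Nat.zero_le k') h3 (hτμ 0) (hτq 0)
      (hτμ k') (hτq k') _

/-! ### §4 The admissible sets in the `T`-currency of the END theorem -/

/-- **The admissible finite set `T = {v ∣ 3} ∪ {bad v}` and its `T`-currency properties at every
depth** (datum-independent): with `S(T) = ∞ ∪ T` (`finSupport T`), for every `k′` — every
`v ∉ T` has `3^{k′+1} ∉ v` and `E[3^{k′+1}]` unramified at `v` (`hT`, Silverman VII.4.1),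
`𝓕_can(E[3^{k′+1}])` and the Kummer structure `𝓛(3^{k′+1})` are unramified outside `S(T)`
(`h𝓕T`, `h𝓚T`: p05 / x11b), `E[3^{k′+1}]` is finite (`hfinT`) and `Sel_{3^{k′+1}}(E/ℚ)` is finite
(`hfinS`, Silverman X.4.2 (b)); moreover `3 ∈ v₃ → v₃ ∈ T`, and a place of `T` is bad or above `3`.
[cite: SilvermanAEC2009, Prop. VII.4.1(a), Cor. X.4.4 and Thm. X.4.2(b)]
[cite: Howard2004HeegnerKolyvagin, Def. 2.1.10 (arXiv:1202.6340 p. 6)] -/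
theorem towerAdmissible :
    ∃ T : Finset (HeightOneSpectrum (𝓞 ℚ)),
      (∀ v : HeightOneSpectrum (𝓞 ℚ), ((3 : ℕ) : 𝓞 ℚ) ∈ v.asIdeal → v ∈ T) ∧
      (∀ v : HeightOneSpectrum (𝓞 ℚ), ¬ W.HasGoodReductionAt v → v ∈ T) ∧
      (∀ v ∈ T, ¬ W.HasGoodReductionAt v ∨ ((3 : ℕ) : 𝓞 ℚ) ∈ v.asIdeal) ∧
      (∀ k', ∀ v : HeightOneSpectrum (𝓞 ℚ), v ∉ T →
        (((3 ^ (k' + 1) : ℕ) : ℕ) : 𝓞 ℚ) ∉ v.asIdeal ∧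
          GaloisRep.IsUnramifiedAt v (W.torsionGaloisModule (((3 : ℕ) : ℤ) ^ k' * ((3 : ℕ) : ℤ)))) ∧
      (∀ k', (propagatedSelmerStructure W 3 k').IsUnramifiedOutside (finSupport T)) ∧
      (∀ k', (W.kummerSelmerStructure (((3 : ℕ) : ℤ) ^ k' * ((3 : ℕ) : ℤ))).IsUnramifiedOutside
        (finSupport T)) ∧
      (∀ k', Finite (geomTorsion W (((3 : ℕ) : ℤ) ^ k' * ((3 : ℕ) : ℤ)))) ∧
      (∀ k', Finite (W.kummerSelmerStructure (((3 : ℕ) : ℤ) ^ k' * ((3 : ℕ) : ℤ))).selmerGroup) := by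
  haveI : Fact (Nat.Prime 3) := ⟨Nat.prime_three⟩
  -- the finite sets of places above `3` and of bad places
  have hbadfin : {v : HeightOneSpectrum (𝓞 ℚ) | ¬ W.HasGoodReductionAt v}.Finite := by
    have h := W.eventually_hasGoodReductionAt
    rwa [Filter.eventually_cofinite] at h
  have h30 : (Ideal.span {((3 : ℕ) : 𝓞 ℚ)} : Ideal (𝓞 ℚ)) ≠ 0 := by
    rw [Ne, Ideal.zero_eq_bot, Ideal.span_singleton_eq_bot]
    exact_mod_cast Nat.prime_three.ne_zero
  have h3fin : {v : HeightOneSpectrum (𝓞 ℚ) | ((3 : ℕ) : 𝓞 ℚ) ∈ v.asIdeal}.Finite := by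
    refine (Ideal.finite_factors h30).subset fun v hv => ?_
    exact (Ideal.dvd_span_singleton).mpr hv
  set T : Finset (HeightOneSpectrum (𝓞 ℚ)) := h3fin.toFinset ∪ hbadfin.toFinset with hTdef
  have h3T : ∀ v : HeightOneSpectrum (𝓞 ℚ), ((3 : ℕ) : 𝓞 ℚ) ∈ v.asIdeal → v ∈ T := fun v hv =>
    Finset.mem_union.mpr (Or.inl (h3fin.mem_toFinset.mpr hv))
  have hbadT : ∀ v : HeightOneSpectrum (𝓞 ℚ), ¬ W.HasGoodReductionAt v → v ∈ T := fun v hv =>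
    Finset.mem_union.mpr (Or.inr (hbadfin.mem_toFinset.mpr hv))
  have hTmem : ∀ v ∈ T, ¬ W.HasGoodReductionAt v ∨ ((3 : ℕ) : 𝓞 ℚ) ∈ v.asIdeal := fun v hv => by
    rcases Finset.mem_union.mp hv with h | h
    · exact Or.inr (h3fin.mem_toFinset.mp h)
    · exact Or.inl (hbadfin.mem_toFinset.mp h)
  -- `S(T)` in the `Place` currency
  have hS : ∀ w : InfinitePlace ℚ, (Sum.inl w : Place ℚ) ∈ finSupport T := inl_mem_finSupport T
  have h3S : ∀ v : HeightOneSpectrum (𝓞 ℚ), ((3 : ℕ) : 𝓞 ℚ) ∈ v.asIdeal →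
      (Sum.inr v : Place ℚ) ∈ finSupport T := fun v hv => (inr_mem_finSupport_iff T v).mpr (h3T v hv)
  have hbadS : ∀ v : HeightOneSpectrum (𝓞 ℚ), ¬ W.HasGoodReductionAt v →
      (Sum.inr v : Place ℚ) ∈ finSupport T := fun v hv => (inr_mem_finSupport_iff T v).mpr (hbadT v hv)
  refine ⟨T, h3T, hbadT, hTmem, fun k' v hv => ?_, fun k' => ?_, fun k' => ?_, fun k' => ?_,
    fun k' => ?_⟩
  · have hvS : (Sum.inr v : Place ℚ) ∉ finSupport T := fun h => hv ((inr_mem_finSupport_iff T v).mp h)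
    obtain ⟨h3v, hunr⟩ := not_mem_and_isUnramifiedAt_of_not_mem W 3 k' (finSupport T) h3S hbadS hvS
    exact ⟨v.natCast_pow_not_mem h3v (k' + 1), hunr⟩
  · exact propagatedSelmerStructure_isUnramifiedOutside W 3 k' (finSupport T) hS h3S hbadS
  · refine ⟨hS, fun v hvS => ?_⟩
    obtain ⟨h3v, -⟩ := not_mem_and_isUnramifiedAt_of_not_mem W 3 k' (finSupport T) h3S hbadS hvS
    have hgood : W.HasGoodReductionAt v := by
      by_contra h
      exact hvS (hbadS v h)
    exact kummerSelmerStructure_inr_eq_unramifiedSubgroup_pow_mul W 3 k' h3v hgood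
  · exact finite_geomTorsion_pow_mul W 3 k'
  · rw [← selmerGroup_eq_selmerGroup_kummerSelmerStructure]
    exact W.finite_selmerGroup_holds (mul_ne_zero (pow_ne_zero _ (by norm_num)) (by norm_num))

end Summit.BirchSwinnertonDyer.Rank1Residual.GaloisImage.TowerPackage

end
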